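import Literature.Computability.QuantumComplexity.HaarUnitaryHiding
import Literature.Probability.RandomMatrix.TruncationHybrid
import HarnessLib

/-!
# Truncations of Haar unitaries are close to Gaussian: proof of AA13 Thm. 5.1

This file discharges the named fact `haarUnitaryTruncation_tv` of `HaarUnitaryHiding.lean`
(S. Aaronson, A. Arkhipov, *The computational complexity of linear optics*, Theory of Computing 9
(2013), Thm. 5.1, p. 183: for `m ≥ (n⁵/δ) log²(n/δ)`, `‖𝒮_{m,n} − 𝒢^{n×n}‖ = O(δ)`):
`haarUnitaryTruncation_tv_holds`, with the constants `C = 10`, `δ₀ = e⁻¹`.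

AA13 prove Thm. 5.1 (and the pointwise Thm. 5.2) from Réffy's explicit density of `𝒮_{m,n}`
(vendored in `HaarUnitaryHidingProofs.lean` as the named fact `truncatedHaarDensity`, a Jacobian
computation on `U(m)` not available in Mathlib). The proof given here is a different, self-contained
one for the total-variation statement, by a column-by-column hybrid argument:

1. `truncatedHaarMeasure_eq_map_gsTruncMatrix`: `𝒮_{m,n}` is the law of
   `(√m · (gramSchmidtNormed g j)_i)_{i,j<n}` for `g ∼ ginibre m n` (`n` i.i.d. standard complex
   Gaussian vectors of `ℂ^m`). This is *derived* from the tree's representation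
   `truncatedHaarMeasure_eq_map_truncGS` (file `TruncatedHaarGinibre`, for the conjugate-transposed
   array `truncGS`) and the conjugate-transpose invariance of `𝒮_{m,n}`
   (`map_conjTranspose_truncatedHaarMeasure`: `U ↦ U* = U⁻¹` preserves the Haar probability measure);
2. `tvClose_ginibre_map_hybridMatrix` (file `TruncationHybrid`): replacing the raw Gaussian
   columns by Gram–Schmidt columns one at a time costs `≤ 10 n³/m` in total variation in all, each
   step being a conditional comparison of the law of a truncated normalised Gaussian projection with
   `γ^n` (the complex Diaconis–Freedman sphere bound `tvClose_sphereTrunc`, `≤ 8n²/m`, plus the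
   Gaussian contraction bound `tvClose_gaussianPi_map_mulVec`, `≤ 2nk/m` on average by symmetry);
3. `ginibre_map_hybridMatrix_zero`: the starting law is `𝒢^{n×n}`.

Hence `‖𝒮_{m,n} − 𝒢^{n×n}‖_TV ≤ 10 n³/m` for `1 ≤ n`, `2n ≤ m` (`tvClose_truncatedHaarMeasure`),
and `10 n³/m ≤ 10 δ` under AA13's hypothesis `m ≥ (n⁵/δ) log²(n/δ)` with `δ ≤ e⁻¹` (so that
`log(n/δ) ≥ 1` and `m ≥ 2n`). The rate `n³/m` is far from optimal (the truth is `Θ(n²/m)`, cf.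
Jiang 2006) but stronger than AA13's `n⁵ log²`.

## References

* S. Aaronson, A. Arkhipov, *The computational complexity of linear optics*, Theory of Computing
  9 (2013) 143–252, Thm. 5.1 (p. 183).
* P. Diaconis, D. Freedman, Ann. IHP 23 (1987) 397–423, Thm. 1; F. Mezzadri, Notices AMS 54
  (2007) 592–604.
-/

open MeasureTheory ProbabilityTheory WithLp Matrix InnerProductSpace
open scoped ENNReal NNReal

namespace Literature.Computability.QuantumComplexity

open Literature.Probability.RandomMatrix Literature.MeasureTheory.TotalVariation
open Literature.MathematicalPhysics.QuantumFieldTheory (haarProbability)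

/-- **Conjugate-transpose invariance of `𝒮_{m,n}`.** The law of the scaled `n × n` block of a
Haar unitary is invariant under `X ↦ X*` (`U ↦ U* = U⁻¹` preserves the Haar probability measure of
the compact group `U(m)` and commutes with truncation and scaling). [folklore] -/
theorem map_conjTranspose_truncatedHaarMeasure {m n : ℕ} (h : n ≤ m) :
    (truncatedHaarMeasure m n h).map (fun (X : Fin n → Fin n → ℂ) i j => starRingEnd ℂ (X j i)) =
      truncatedHaarMeasure m n h := by
  have hcT : Measurable fun (X : Fin n → Fin n → ℂ) (i j : Fin n) => starRingEnd ℂ (X j i) :=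
    measurable_pi_lambda _ fun i => measurable_pi_lambda _ fun j =>
      Complex.continuous_conj.measurable.comp ((measurable_pi_apply i).comp (measurable_pi_apply j))
  have hinv : Measurable (Inv.inv : Matrix.unitaryGroup (Fin m) ℂ → Matrix.unitaryGroup (Fin m) ℂ) :=
    measurable_inv
  rw [truncatedHaarMeasure, Measure.map_map hcT (measurable_scaledTruncation n h)]
  have hcomp : (fun (X : Fin n → Fin n → ℂ) (i j : Fin n) => starRingEnd ℂ (X j i)) ∘ scaledTruncation n h =
      scaledTruncation n h ∘ (Inv.inv : Matrix.unitaryGroup (Fin m) ℂ → Matrix.unitaryGroup (Fin m) ℂ) := by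
    funext U; funext i j
    simp only [Function.comp_apply, scaledTruncation_apply, Matrix.UnitaryGroup.inv_apply,
      Matrix.star_apply, map_mul, Complex.conj_ofReal, Complex.star_def]
  rw [hcomp, ← Measure.map_map (measurable_scaledTruncation n h) hinv, Measure.map_inv_eq_self]

/-- **`𝒮_{m,n}` as a Gaussian functional**: the scaled truncated Haar law is the law of the scaled
truncated Gram–Schmidt array `(√m (gramSchmidtNormed ℂ g j)_i)_{i,j<n}` of `g ∼ ginibre m n`.
Derived from the tree's `truncatedHaarMeasure_eq_map_truncGS` (`gsTruncMatrix` is the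
entrywise-conjugate transpose of `truncGS`) and `map_conjTranspose_truncatedHaarMeasure`.
[cite: Mezzadri2007, §4–5 (Haar unitaries by QR of Ginibre)] -/
theorem truncatedHaarMeasure_eq_map_gsTruncMatrix {m n : ℕ} (h : n ≤ m) :
    truncatedHaarMeasure m n h = (ginibre m n).map (gsTruncMatrix h) := by
  have hcT : Measurable fun (X : Fin n → Fin n → ℂ) (i j : Fin n) => starRingEnd ℂ (X j i) :=
    measurable_pi_lambda _ fun i => measurable_pi_lambda _ fun j =>
      Complex.continuous_conj.measurable.comp ((measurable_pi_apply i).comp (measurable_pi_apply j))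
  have hfun : gsTruncMatrix (m := m) h =
      (fun (X : Fin n → Fin n → ℂ) (i j : Fin n) => starRingEnd ℂ (X j i)) ∘ truncGS m n h := by
    funext ω; funext i j
    simp only [Function.comp_apply, gsTruncMatrix, truncGS, map_mul, Complex.conj_ofReal,
      Complex.conj_conj]
  rw [hfun, ← Measure.map_map hcT (measurable_truncGS m n h), ← truncatedHaarMeasure_eq_map_truncGS,
    map_conjTranspose_truncatedHaarMeasure]

/-- **`‖𝒮_{m,n} − 𝒢^{n×n}‖_TV ≤ 10 n³/m`** for `1 ≤ n`, `2n ≤ m`: the setwise total-variation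
bound between the scaled `n × n` truncation of a Haar unitary of `U(m)` and the Ginibre ensemble
(hybrid argument). [folklore] -/
theorem tvClose_truncatedHaarMeasure {m n : ℕ} (hn : 1 ≤ n) (hmn : 2 * n ≤ m) (h : n ≤ m) :
    TVClose (truncatedHaarMeasure m n h) (gaussianMatrixMeasure n) (10 * (n:ℝ) ^ 3 / m) := by
  rw [truncatedHaarMeasure_eq_map_gsTruncMatrix h, ← ginibre_map_hybridMatrix_zero h]
  exact (tvClose_ginibre_map_hybridMatrix hn hmn h).symm

/-- **AA13 Thm. 5.1 (Truncations of Haar unitaries are close to Gaussian), discharged.** There are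
absolute constants (`C = 10`, `δ₀ = e⁻¹`) such that for `n ≥ 1`, `0 < δ ≤ δ₀` and
`m ≥ (n⁵/δ) log²(n/δ)`, `|𝒮_{m,n}(E) − 𝒢^{n×n}(E)| ≤ C δ` for every measurable `E`.
[cite: AaronsonArkhipovToC2013, Thm. 5.1 (p. 183)] -/
theorem haarUnitaryTruncation_tv_holds : haarUnitaryTruncation_tv := by
  refine ⟨10, Real.exp (-1), Real.exp_pos _, ?_⟩
  intro n m h δ hn hδ hδ₀ hm E hE
  have hn1 : (1:ℝ) ≤ n := by exact_mod_cast hn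
  -- `1/δ ≥ e`, hence `log (n/δ) ≥ 1`
  have hinvδ : Real.exp 1 ≤ 1 / δ := by
    rw [le_div_iff₀ hδ]
    calc Real.exp 1 * δ ≤ Real.exp 1 * Real.exp (-1) := by gcongr
      _ = 1 := by rw [← Real.exp_add]; norm_num
  have hnd : Real.exp 1 ≤ n / δ := by
    calc Real.exp 1 ≤ 1 / δ := hinvδ
      _ ≤ n / δ := by gcongr
  have hlog : 1 ≤ Real.log (n / δ) := by
    rw [← Real.log_exp 1]
    exact Real.log_le_log (Real.exp_pos 1) hnd
  have hlog2 : 1 ≤ Real.log (n / δ) ^ 2 := by nlinarith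
  have h5 : (n:ℝ) ^ 5 / δ ≤ m := by
    have h0 : 0 ≤ (n:ℝ) ^ 5 / δ := by positivity
    calc (n:ℝ) ^ 5 / δ = (n:ℝ) ^ 5 / δ * 1 := (mul_one _).symm
      _ ≤ (n:ℝ) ^ 5 / δ * Real.log (n / δ) ^ 2 := by gcongr
      _ ≤ m := hm
  have he2 : (2:ℝ) ≤ Real.exp 1 := by
    have := Real.add_one_le_exp (1:ℝ); linarith
  -- `m ≥ 2n`
  have h2n : 2 * n ≤ m := by
    have h1 : (2:ℝ) * n ≤ (n:ℝ) ^ 5 / δ := by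
      have hn5 : (n:ℝ) ≤ (n:ℝ) ^ 5 := by
        calc (n:ℝ) = (n:ℝ) ^ 1 := (pow_one _).symm
          _ ≤ (n:ℝ) ^ 5 := pow_le_pow_right₀ hn1 (by norm_num)
      calc (2:ℝ) * n ≤ Real.exp 1 * n := by gcongr
        _ ≤ (1 / δ) * n := by gcongr
        _ = n / δ := by ring
        _ ≤ (n:ℝ) ^ 5 / δ := by gcongr
    have : ((2 * n : ℕ) : ℝ) ≤ m := by push_cast; linarith
    exact_mod_cast this
  have hm0 : (0:ℝ) < m := by
    have : 0 < m := by omega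
    exact_mod_cast this
  -- `10 n³/m ≤ 10 δ`
  have hrate : 10 * (n:ℝ) ^ 3 / m ≤ 10 * δ := by
    have h1 : (n:ℝ) ^ 5 ≤ δ * m := by
      have := mul_le_mul_of_nonneg_left h5 hδ.le
      rwa [mul_div_cancel₀ _ hδ.ne'] at this
    have h2 : (n:ℝ) ^ 3 ≤ (n:ℝ) ^ 5 := pow_le_pow_right₀ hn1 (by norm_num)
    rw [mul_div_assoc]
    refine mul_le_mul_of_nonneg_left ?_ (by norm_num)
    rw [div_le_iff₀ hm0]
    linarith
  exact ((tvClose_truncatedHaarMeasure hn h2n h).mono hrate) E hE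

end Literature.Computability.QuantumComplexity
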